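import Literature.Analysis.FluidPDE.ElgindiEllipticClassicalSolution
import Literature.Analysis.FluidPDE.ElgindiEllipticRadialRegularity
import Literature.Analysis.FluidPDE.ElgindiWeightedEnergyBound
import Literature.Analysis.FluidPDE.ElgindiMomentCalculus
import Literature.Analysis.FluidPDE.ElgindiCutoffCalculus
import Literature.Analysis.FluidPDE.ElgindiStripIterates
import HarnessLib

/-!
# Tangential regularity of the weak solution: all `D_R`-derivatives have finite (weighted) energy
([Elgindi2021] §7.3, "`D_R` commutes with `L`"; [EGM] proof of Theorem 3)

Topic `Literature/Analysis/FluidPDE`. Support file (definitions with bodies and proved theorems, no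
named facts) on the proof path of the named fact
`Literature.Analysis.FluidPDE.Elgindi.ElgindiGhoulMasmoudi2021_stabilityCore`
(`ElgindiStabilityDecomposition.lean`). T. M. Elgindi, Ann. of Math. 194 (2021) =
arXiv:1904.04795, §7.3 proof of Proposition 7.7, Step 3 (p. 21: "`D_R` commutes with the
equation"), and Elgindi–Ghoul–Masmoudi, arXiv:1910.14071, proof of Theorem 3 (p. 13).

For a smooth datum `f` compactly supported inside `R > 0` and orthogonal to `K` slice by slice,
let `Ψ̃ ∈ C^∞(strip)` be the smooth representative of the first component of the weak solution
(`ElgindiEllipticClassicalSolution.lean`). We identify, for every `j`, the weak solution `U⁽ʲ⁾` with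
datum `D_R^j f` (radial difference quotients, `ElgindiEllipticRadialRegularity.lean`) with the
classical derivatives of `Ψ̃`:
`U⁽ʲ⁾₀ = D_R^jΨ̃`, `U⁽ʲ⁾₁ = αD_R^{j+1}Ψ̃`, `U⁽ʲ⁾₂ = ∂_θD_R^jΨ̃`, `U⁽ʲ⁾₃ = tan θ·D_R^jΨ̃` a.e. on the
strip (`weakSol_components_ae_eq`). Consequently all of `D_R^jΨ̃, ∂_θD_R^jΨ̃, tan θD_R^jΨ̃` are
square integrable on the strip, also against the radial weight `w² = (1+R)⁴/R⁴` when `α ≤ 1/4`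
(`tangential_sq_integrable`, `tangential_weighted_sq_integrable`).
-/

noncomputable section

open MeasureTheory Set Real Filter Function
open _root_.Topology
open scoped ENNReal InnerProductSpace ContDiff

namespace Literature.Analysis.FluidPDE

namespace Elgindi

/-! ### Integration by parts against test functions of the open strip -/

/-- **Radial integration by parts on the strip**: for `g ∈ C^∞(strip)` and a smooth `φ` compactly
supported in the open strip, `∫∫ (R∂_Rg)φ = −∫∫ g(φ + R∂_Rφ)`. [folklore] -/
theorem integral_strip_Dz_mul_test {g : ℝ × ℝ → ℝ} (hg : ContDiffOn ℝ ∞ g strip) {φ : ℝ → ℝ → ℝ}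
    (hφ : ∀ n : ℕ, ContDiff ℝ n (uncurry φ)) (hφs : HasCompactSupport (uncurry φ)) (hφS : tsupport (uncurry φ) ⊆ strip) :
    ∫ p in strip, Dz (fun R θ => g (R, θ)) p.1 p.2 * φ p.1 p.2 = -∫ p in strip, g p * (φ p.1 p.2 + p.1 * dz φ p.1 p.2) := by
  -- replace `g` by a compactly supported smooth `g̃` agreeing with it near the support of `φ`
  obtain ⟨W, gt, hW, hKW, hWS, hgt, hgts, hgtS, hEq⟩ := exists_test_eqOn hg hφs.isCompact hφS
  have hφ1 : ContDiff ℝ 1 (uncurry φ) := hφ 1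
  have hgt1 : ContDiff ℝ 1 (uncurry fun R θ => gt (R, θ)) := hgt.of_le (by norm_num)
  -- outside `tsupport φ` both sides vanish; inside `W` the functions agree
  have hφ0 : ∀ p, p ∉ tsupport (uncurry φ) → φ p.1 p.2 = 0 := fun p hp => by
    have := image_eq_zero_of_notMem_tsupport hp; exact this
  have hdzφ0 : ∀ p, p ∉ tsupport (uncurry φ) → dz φ p.1 p.2 = 0 := fun p hp => by
    have hsub : tsupport (uncurry (dz φ)) ⊆ tsupport (uncurry φ) := tsupport_dz_subset
    have := image_eq_zero_of_notMem_tsupport fun h' => hp (hsub h'); exact this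
  have eL : ∀ p ∈ strip, Dz (fun R θ => g (R, θ)) p.1 p.2 * φ p.1 p.2 = Dz (fun R θ => gt (R, θ)) p.1 p.2 * φ p.1 p.2 := by
    intro p _
    by_cases hp : p ∈ tsupport (uncurry φ)
    · have hpW : p ∈ W := hKW hp
      have e := eqOn_dz (f := fun R θ => g (R, θ)) (g := fun R θ => gt (R, θ)) hW (fun q hq => (hEq hq).symm) hpW
      show p.1 * dz (fun R θ => g (R, θ)) p.1 p.2 * φ p.1 p.2 = p.1 * dz (fun R θ => gt (R, θ)) p.1 p.2 * φ p.1 p.2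
      rw [e]
    · rw [hφ0 p hp, mul_zero, mul_zero]
  have eR : ∀ p ∈ strip, g p * (φ p.1 p.2 + p.1 * dz φ p.1 p.2) = gt p * (φ p.1 p.2 + p.1 * dz φ p.1 p.2) := by
    intro p _
    by_cases hp : p ∈ tsupport (uncurry φ)
    · rw [hEq (hKW hp)]
    · rw [hφ0 p hp, hdzφ0 p hp, mul_zero, add_zero, mul_zero, mul_zero]
  rw [setIntegral_congr_fun measurableSet_strip eL, setIntegral_congr_fun measurableSet_strip eR]
  -- now everything is global: `H = R g̃ φ` has `∂_R H = (R∂_R g̃)φ + g̃(φ + R∂_Rφ)`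
  set G : ℝ → ℝ → ℝ := fun R θ => gt (R, θ) with hG
  have cG : Continuous fun p : ℝ × ℝ => G p.1 p.2 := hgt1.continuous
  have cdzG : Continuous fun p : ℝ × ℝ => dz G p.1 p.2 := (contDiff_dz_of_contDiff (n := 0) hgt1).continuous
  have cφ : Continuous fun p : ℝ × ℝ => φ p.1 p.2 := hφ1.continuous
  have cdzφ : Continuous fun p : ℝ × ℝ => dz φ p.1 p.2 := (contDiff_dz_of_contDiff (n := 0) hφ1).continuous
  have sφ : HasCompactSupport fun p : ℝ × ℝ => φ p.1 p.2 := hφs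
  have sdzφ : HasCompactSupport fun p : ℝ × ℝ => dz φ p.1 p.2 := hasCompactSupport_dz hφs
  have iL : Integrable fun p : ℝ × ℝ => Dz G p.1 p.2 * φ p.1 p.2 := by
    have : Continuous fun p : ℝ × ℝ => Dz G p.1 p.2 := by
      show Continuous fun p : ℝ × ℝ => p.1 * dz G p.1 p.2; fun_prop
    exact (this.mul cφ).integrable_of_hasCompactSupport sφ.mul_left
  have iR : Integrable fun p : ℝ × ℝ => G p.1 p.2 * (φ p.1 p.2 + p.1 * dz φ p.1 p.2) :=
    ((cG.mul (cφ.add (continuous_fst.mul cdzφ))).integrable_of_hasCompactSupport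
      ((sφ.add (sdzφ.mul_left)).mul_left))
  have key : ∫ p in strip, (Dz G p.1 p.2 * φ p.1 p.2 + G p.1 p.2 * (φ p.1 p.2 + p.1 * dz φ p.1 p.2)) = 0 := by
    -- the integrand vanishes off `tsupport φ ⊆ strip`, so integrate over the plane, `θ` outer
    have h0 : ∀ p, p ∉ strip → Dz G p.1 p.2 * φ p.1 p.2 + G p.1 p.2 * (φ p.1 p.2 + p.1 * dz φ p.1 p.2) = 0 := fun p hp => by
      have hp' : p ∉ tsupport (uncurry φ) := fun h => hp (hφS h)
      rw [hφ0 p hp', hdzφ0 p hp']; ring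
    rw [setIntegral_eq_integral_of_forall_compl_eq_zero fun p hp => h0 p hp]
    have iS : Integrable fun p : ℝ × ℝ => Dz G p.1 p.2 * φ p.1 p.2 + G p.1 p.2 * (φ p.1 p.2 + p.1 * dz φ p.1 p.2) := iL.add iR
    rw [Measure.volume_eq_prod, integral_prod_symm _ (by simpa [Measure.volume_eq_prod] using iS)]
    refine integral_eq_zero_of_ae (ae_of_all _ fun θ => ?_)
    -- slice: `∫_ℝ ∂_R(R G φ) dR = 0`
    have hdG : ∀ R, HasDerivAt (fun R' => G R' θ) (dz G R θ) R := fun R =>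
      (((hgt1.comp (contDiff_id.prodMk contDiff_const)).differentiable (by simp)) R).hasDerivAt
    have hdφ : ∀ R, HasDerivAt (fun R' => φ R' θ) (dz φ R θ) R := fun R =>
      (((hφ1.comp (contDiff_id.prodMk contDiff_const)).differentiable (by simp)) R).hasDerivAt
    have hH : ∀ R, HasDerivAt (fun R' => R' * G R' θ * φ R' θ) (Dz G R θ * φ R θ + G R θ * (φ R θ + R * dz φ R θ)) R := by
      intro R
      have h := ((hasDerivAt_id R).mul (hdG R)).mul (hdφ R)
      refine h.congr_deriv ?_
      have edz : dz G R θ = deriv (fun R' => G R' θ) R := rfl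
      simp only [id, Pi.mul_apply, Dz, edz]
      ring
    have hvs : HasCompactSupport fun R' => φ R' θ :=
      HasCompactSupport.of_support_subset_isCompact (hφs.image continuous_fst) fun R hR => ⟨(R, θ), subset_tsupport _ hR, rfl⟩
    have sH : HasCompactSupport fun R' => R' * G R' θ * φ R' θ := hvs.mul_left
    have sH' : HasCompactSupport fun R' => Dz G R' θ * φ R' θ + G R' θ * (φ R' θ + R' * dz φ R' θ) :=
      (hvs.mul_left).add ((hvs.add (hvs.deriv.mul_left (f := fun R' => R'))).mul_left)
    have cH' : Continuous fun R' => Dz G R' θ * φ R' θ + G R' θ * (φ R' θ + R' * dz φ R' θ) := by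
      show Continuous fun R' => R' * dz G R' θ * φ R' θ + G R' θ * (φ R' θ + R' * dz φ R' θ)
      fun_prop
    have h0 : Tendsto (fun R' => R' * G R' θ * φ R' θ) (cocompact ℝ) (𝓝 0) := sH.is_zero_at_infty
    have := integral_of_hasDerivAt_of_tendsto hH (cH'.integrable_of_hasCompactSupport sH') (h0.mono_left atBot_le_cocompact)
      (h0.mono_left atTop_le_cocompact)
    rw [sub_zero] at this
    exact this
  rw [integral_add iL.integrableOn iR.integrableOn] at key
  have eG : ∫ p in strip, gt p * (φ p.1 p.2 + p.1 * dz φ p.1 p.2) = ∫ p in strip, G p.1 p.2 * (φ p.1 p.2 + p.1 * dz φ p.1 p.2) := by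
    rfl
  rw [eG]
  linarith

/-- **Angular integration by parts on the strip**: `∫∫ (∂_θg)φ = −∫∫ g∂_θφ` for `g ∈ C^∞(strip)` and
smooth `φ` compactly supported in the open strip. [folklore] -/
theorem integral_strip_dθ_mul_test {g : ℝ × ℝ → ℝ} (hg : ContDiffOn ℝ ∞ g strip) {φ : ℝ → ℝ → ℝ}
    (hφ : ∀ n : ℕ, ContDiff ℝ n (uncurry φ)) (hφs : HasCompactSupport (uncurry φ)) (hφS : tsupport (uncurry φ) ⊆ strip) :
    ∫ p in strip, dθ (fun R θ => g (R, θ)) p.1 p.2 * φ p.1 p.2 = -∫ p in strip, g p * dθ φ p.1 p.2 := by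
  obtain ⟨W, gt, hW, hKW, hWS, hgt, hgts, hgtS, hEq⟩ := exists_test_eqOn hg hφs.isCompact hφS
  have hφ1 : ContDiff ℝ 1 (uncurry φ) := hφ 1
  have hgt1 : ContDiff ℝ 1 (uncurry fun R θ => gt (R, θ)) := hgt.of_le (by norm_num)
  have hφ0 : ∀ p, p ∉ tsupport (uncurry φ) → φ p.1 p.2 = 0 := fun p hp => by
    have := image_eq_zero_of_notMem_tsupport hp; exact this
  have hdθφ0 : ∀ p, p ∉ tsupport (uncurry φ) → dθ φ p.1 p.2 = 0 := fun p hp => by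
    have hsub : tsupport (uncurry (dθ φ)) ⊆ tsupport (uncurry φ) := tsupport_dθ_subset' φ
    have := image_eq_zero_of_notMem_tsupport fun h' => hp (hsub h'); exact this
  have eL : ∀ p ∈ strip, dθ (fun R θ => g (R, θ)) p.1 p.2 * φ p.1 p.2 = dθ (fun R θ => gt (R, θ)) p.1 p.2 * φ p.1 p.2 := by
    intro p _
    by_cases hp : p ∈ tsupport (uncurry φ)
    · rw [eqOn_dθ (f := fun R θ => g (R, θ)) (g := fun R θ => gt (R, θ)) hW (fun q hq => (hEq hq).symm) (hKW hp)]
    · rw [hφ0 p hp, mul_zero, mul_zero]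
  have eR : ∀ p ∈ strip, g p * dθ φ p.1 p.2 = gt p * dθ φ p.1 p.2 := by
    intro p _
    by_cases hp : p ∈ tsupport (uncurry φ)
    · rw [hEq (hKW hp)]
    · rw [hdθφ0 p hp, mul_zero, mul_zero]
  rw [setIntegral_congr_fun measurableSet_strip eL, setIntegral_congr_fun measurableSet_strip eR]
  set G : ℝ → ℝ → ℝ := fun R θ => gt (R, θ) with hG
  have cG : Continuous fun p : ℝ × ℝ => G p.1 p.2 := hgt1.continuous
  have cdθG : Continuous fun p : ℝ × ℝ => dθ G p.1 p.2 := (contDiff_dθ_of_contDiff (n := 0) hgt1).continuous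
  have cφ : Continuous fun p : ℝ × ℝ => φ p.1 p.2 := hφ1.continuous
  have cdθφ : Continuous fun p : ℝ × ℝ => dθ φ p.1 p.2 := (contDiff_dθ_of_contDiff (n := 0) hφ1).continuous
  have sφ : HasCompactSupport fun p : ℝ × ℝ => φ p.1 p.2 := hφs
  have sdθφ : HasCompactSupport fun p : ℝ × ℝ => dθ φ p.1 p.2 := hasCompactSupport_dθ_of hφs
  have iL : Integrable fun p : ℝ × ℝ => dθ G p.1 p.2 * φ p.1 p.2 := (cdθG.mul cφ).integrable_of_hasCompactSupport sφ.mul_left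
  have iR : Integrable fun p : ℝ × ℝ => G p.1 p.2 * dθ φ p.1 p.2 := (cG.mul cdθφ).integrable_of_hasCompactSupport sdθφ.mul_left
  have key : ∫ p in strip, (dθ G p.1 p.2 * φ p.1 p.2 + G p.1 p.2 * dθ φ p.1 p.2) = 0 := by
    have h0 : ∀ p, p ∉ strip → dθ G p.1 p.2 * φ p.1 p.2 + G p.1 p.2 * dθ φ p.1 p.2 = 0 := fun p hp => by
      have hp' : p ∉ tsupport (uncurry φ) := fun h => hp (hφS h)
      rw [hφ0 p hp', hdθφ0 p hp']; ring
    rw [setIntegral_eq_integral_of_forall_compl_eq_zero fun p hp => h0 p hp]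
    have iS : Integrable fun p : ℝ × ℝ => dθ G p.1 p.2 * φ p.1 p.2 + G p.1 p.2 * dθ φ p.1 p.2 := iL.add iR
    rw [Measure.volume_eq_prod, integral_prod _ (by simpa [Measure.volume_eq_prod] using iS)]
    refine integral_eq_zero_of_ae (ae_of_all _ fun R => ?_)
    have hdG : ∀ θ, HasDerivAt (fun θ' => G R θ') (dθ G R θ) θ := fun θ =>
      (((hgt1.comp (contDiff_const.prodMk contDiff_id)).differentiable (by simp)) θ).hasDerivAt
    have hdφ : ∀ θ, HasDerivAt (fun θ' => φ R θ') (dθ φ R θ) θ := fun θ =>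
      (((hφ1.comp (contDiff_const.prodMk contDiff_id)).differentiable (by simp)) θ).hasDerivAt
    have hH : ∀ θ, HasDerivAt (fun θ' => G R θ' * φ R θ') (dθ G R θ * φ R θ + G R θ * dθ φ R θ) θ := fun θ =>
      (hdG θ).mul (hdφ θ)
    have hvs : HasCompactSupport fun θ' => φ R θ' :=
      HasCompactSupport.of_support_subset_isCompact (hφs.image continuous_snd) fun θ hθ => ⟨(R, θ), subset_tsupport _ hθ, rfl⟩
    have sH : HasCompactSupport fun θ' => G R θ' * φ R θ' := hvs.mul_left
    have sH' : HasCompactSupport fun θ' => dθ G R θ' * φ R θ' + G R θ' * dθ φ R θ' := (hvs.mul_left).add (hvs.deriv.mul_left)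
    have cH' : Continuous fun θ' => dθ G R θ' * φ R θ' + G R θ' * dθ φ R θ' := by fun_prop
    have h0 : Tendsto (fun θ' => G R θ' * φ R θ') (cocompact ℝ) (𝓝 0) := sH.is_zero_at_infty
    have := integral_of_hasDerivAt_of_tendsto hH (cH'.integrable_of_hasCompactSupport sH') (h0.mono_left atBot_le_cocompact)
      (h0.mono_left atTop_le_cocompact)
    rw [sub_zero] at this
    exact this
  rw [integral_add iL.integrableOn iR.integrableOn] at key
  have eG : ∫ p in strip, gt p * dθ φ p.1 p.2 = ∫ p in strip, G p.1 p.2 * dθ φ p.1 p.2 := rfl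
  rw [eG]
  linarith


/-! ### Orthogonality to `K` of the radial derivatives of the datum -/

/-- Strip pairings against `n(R)K(θ)` are radial integrals of `K`-moments. [folklore] -/
theorem integral_strip_mul_radial_kernelK {g : ℝ → ℝ → ℝ} (hg : Continuous (uncurry g)) (hs : HasCompactSupport (uncurry g))
    {n : ℝ → ℝ} (hn : Continuous n) :
    ∫ p in strip, g p.1 p.2 * (n p.1 * kernelK p.2) = ∫ R in Ioi 0, n R * kMoment g R := by
  have cK : Continuous kernelK := by unfold kernelK; fun_prop
  have i : Integrable fun p : ℝ × ℝ => g p.1 p.2 * (n p.1 * kernelK p.2) :=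
    ((hg.mul ((hn.comp continuous_fst).mul (cK.comp continuous_snd))).integrable_of_hasCompactSupport hs.mul_right)
  rw [integral_strip_eq_integral_Ioi_integral_Ioo i]
  refine setIntegral_congr_fun measurableSet_Ioi fun R _ => ?_
  rw [kMoment_def, ← MeasureTheory.integral_const_mul]
  exact setIntegral_congr_fun measurableSet_Ioo fun θ _ => by ring

/-- **Orthogonality as vanishing `K`-moments**: if `∫∫ g·n(R)K(θ) = 0` for all continuous compactly
supported `n`, then `kMoment g R = 0` for every `R > 0`. [folklore] -/
theorem kMoment_eq_zero_of_orth {g : ℝ → ℝ → ℝ} (hg : Continuous (uncurry g)) (hs : HasCompactSupport (uncurry g))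
    (HG : ∀ n : ℝ → ℝ, Continuous n → HasCompactSupport n → ∫ p in strip, g p.1 p.2 * (n p.1 * kernelK p.2) = 0)
    {R : ℝ} (hR : 0 < R) : kMoment g R = 0 := by
  have hm : Continuous (kMoment g) := continuous_kMoment hg
  -- the bump `ρ` centred at `R`, supported in `(R/4, 7R/4) ⊆ (0,∞)`
  set ρ : ContDiffBump R := ⟨R / 2, 3 * R / 4, by positivity, by linarith⟩
  have hρc : Continuous ρ := ρ.continuous
  have hρs : HasCompactSupport ρ := ρ.hasCompactSupport
  have hρ0 : ∀ x, 0 ≤ ρ x := fun x => ρ.nonneg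
  have h := HG (fun x => ρ x * kMoment g x) (hρc.mul hm) hρs.mul_right
  rw [integral_strip_mul_radial_kernelK hg hs (n := fun x => ρ x * kMoment g x) (hρc.mul hm)] at h
  -- `∫_{R>0} ρ m² = 0` with a continuous nonnegative integrand equal to `m(R)²` at `R`
  have hvan : ∀ x, x ∉ Ioi (0:ℝ) → ρ x * kMoment g x * kMoment g x = 0 := fun x hx => by
    have hx' : x ∉ support (ρ : ℝ → ℝ) := fun hxs => by
      rw [ρ.support_eq, Metric.mem_ball, Real.dist_eq] at hxs
      simp only [Set.mem_Ioi, not_lt] at hx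
      have h3 : |x - R| < 3 * R / 4 := hxs
      rw [abs_lt] at h3
      linarith
    rw [notMem_support.1 hx', zero_mul, zero_mul]
  have e : ∫ x in Ioi (0:ℝ), ρ x * kMoment g x * kMoment g x = ∫ x, ρ x * kMoment g x ^ 2 := by
    rw [setIntegral_eq_integral_of_forall_compl_eq_zero hvan]
    exact integral_congr_ae (ae_of_all _ fun x => by ring)
  rw [e] at h
  have hcont : Continuous fun x => ρ x * kMoment g x ^ 2 := hρc.mul (hm.pow 2)
  have hnn : ∀ x, 0 ≤ ρ x * kMoment g x ^ 2 := fun x => mul_nonneg (hρ0 x) (sq_nonneg _)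
  by_contra hne
  have hx0 : ρ R * kMoment g R ^ 2 ≠ 0 := by
    have h1 : ρ R = 1 := ρ.one_of_mem_closedBall (Metric.mem_closedBall_self (by positivity))
    rw [h1, one_mul]; exact pow_ne_zero 2 hne
  have hpos := hcont.integral_pos_of_hasCompactSupport_nonneg_nonzero (μ := volume) hρs.mul_right hnn hx0
  linarith

/-- **The radial derivatives `D_R^j f` of an orthogonal datum are orthogonal to `K`.** [folklore] -/
theorem orth_iterate_Dz {f : ℝ → ℝ → ℝ} (hfn : ∀ n : ℕ, ContDiff ℝ n (uncurry f)) (hfs : HasCompactSupport (uncurry f))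
    (HF : ∀ n : ℝ → ℝ, Continuous n → HasCompactSupport n → ∫ p in strip, f p.1 p.2 * (n p.1 * kernelK p.2) = 0) (j : ℕ) :
    ∀ n : ℝ → ℝ, Continuous n → HasCompactSupport n → ∫ p in strip, (Dz^[j] f) p.1 p.2 * (n p.1 * kernelK p.2) = 0 := by
  intro n hn _
  have hjc : Continuous (uncurry (Dz^[j] f)) := (contDiff_iterate_Dz_of_contDiff (n := 0) (m := j) (by simpa using hfn (0 + j))).continuous
  rw [integral_strip_mul_radial_kernelK hjc (hasCompactSupport_iterate_Dz hfs j) hn]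
  refine (setIntegral_congr_fun measurableSet_Ioi fun R hR => ?_).trans (integral_zero _ _)
  have hK0 : ∀ z ∈ Ioi (0:ℝ), kMoment f z = 0 := fun z hz => kMoment_eq_zero_of_orth (hfn 0).continuous hfs HF hz
  rw [← iterate_Dz₁_kMoment (hfn j) hfs R, iterate_Dz₁_eq_zero_of_eqOn isOpen_Ioi hK0 j R hR, mul_zero]

/-! ### Identification of a.e. classes against test functions of the strip -/

/-- **Test-function identification on the strip**: a locally integrable `u` and a continuous `v` on
the strip with the same pairings against all smooth functions compactly supported in the open strip
agree a.e. on the strip. [folklore] -/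
theorem ae_eq_on_strip_of_test {u v : ℝ × ℝ → ℝ} (hu : LocallyIntegrableOn u strip) (hv : ContinuousOn v strip)
    (h : ∀ φ : ℝ → ℝ → ℝ, (∀ n : ℕ, ContDiff ℝ n (uncurry φ)) → HasCompactSupport (uncurry φ) → tsupport (uncurry φ) ⊆ strip →
      ∫ p in strip, u p * φ p.1 p.2 = ∫ p in strip, v p * φ p.1 p.2) :
    ∀ᵐ y ∂(volume : Measure (ℝ × ℝ)), y ∈ strip → u y = v y := by
  have hvl : LocallyIntegrableOn v strip := hv.locallyIntegrableOn measurableSet_strip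
  have hF : LocallyIntegrableOn (fun y => u y - v y) strip := hu.sub hvl
  have key := isOpen_strip.ae_eq_zero_of_integral_contDiff_smul_eq_zero hF fun g hg hgs hgS => by
    set φ : ℝ → ℝ → ℝ := fun R θ => g (R, θ) with hφ
    have eφ : uncurry φ = g := by funext q; rfl
    have hφn : ∀ n : ℕ, ContDiff ℝ n (uncurry φ) := fun n => by rw [eφ]; exact hg.of_le (by exact_mod_cast le_top)
    have hφs : HasCompactSupport (uncurry φ) := by rw [eφ]; exact hgs
    have hφS : tsupport (uncurry φ) ⊆ strip := by rw [eφ]; exact hgS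
    have hh := h φ hφn hφs hφS
    -- integrability of `g u` and `g v` on the strip (compact support inside the strip)
    have hgb : ∃ C, ∀ x, |g x| ≤ C := by
      obtain ⟨C, hC⟩ := (hg.continuous.norm).bddAbove_range_of_hasCompactSupport hgs.norm
      exact ⟨C, fun x => hC ⟨x, rfl⟩⟩
    obtain ⟨C, hC⟩ := hgb
    have iK : ∀ {w : ℝ × ℝ → ℝ}, LocallyIntegrableOn w strip → IntegrableOn (fun y => w y * φ y.1 y.2) strip := by
      intro w hw
      have iw : IntegrableOn w (tsupport g) := hw.integrableOn_compact_subset hgS hgs.isCompact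
      have i1 : IntegrableOn (fun y => w y * φ y.1 y.2) (tsupport g) := by
        refine Integrable.mono (iw.norm.const_mul C |>.congr (ae_of_all _ fun y => rfl)) ?_ ?_
        · exact (hw.aestronglyMeasurable.mono_set hgS |>.mul ((hg.continuous.aestronglyMeasurable).mono_measure Measure.restrict_le_self))
        · exact ae_of_all _ fun y => by
            rw [Real.norm_eq_abs, abs_mul, Real.norm_eq_abs, Real.norm_eq_abs]
            have hC0 : 0 ≤ C := (abs_nonneg _).trans (hC 0)
            rw [abs_of_nonneg (mul_nonneg hC0 (abs_nonneg _)), mul_comm]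
            exact mul_le_mul_of_nonneg_right (hC _) (abs_nonneg _)
      refine i1.of_forall_sdiff_eq_zero measurableSet_strip fun y hy => ?_
      have : φ y.1 y.2 = 0 := by
        have := image_eq_zero_of_notMem_tsupport (f := uncurry φ) (x := y) (by rw [eφ]; exact hy.2); exact this
      rw [this, mul_zero]
    have iu := iK hu
    have iv := iK hvl
    -- `∫ g • (u − v) = ∫_strip u φ − ∫_strip v φ = 0`
    have h0 : ∀ y, y ∉ strip → g y • (u y - v y) = 0 := fun y hy => by
      have : g y = 0 := image_eq_zero_of_notMem_tsupport fun h' => hy (hgS h')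
      rw [this, zero_smul]
    rw [← setIntegral_eq_integral_of_forall_compl_eq_zero h0]
    have e : ∫ y in strip, g y • (u y - v y) = ∫ y in strip, (u y * φ y.1 y.2 - v y * φ y.1 y.2) :=
      integral_congr_ae (ae_of_all _ fun y => by show g y * (u y - v y) = u y * g (y.1, y.2) - v y * g (y.1, y.2); simp only [Prod.mk.eta]; ring)
    rw [e, integral_sub iu iv, hh, sub_self]
  exact key.mono fun y hy hys => sub_eq_zero.1 (hy hys)

/-- Elements of `L²(strip)` are locally integrable on the strip. [folklore] -/
theorem locallyIntegrableOn_L2 (u : L2Strip) : LocallyIntegrableOn (u : ℝ × ℝ → ℝ) strip := by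
  intro x _
  refine ⟨strip ∩ Metric.ball x 1, inter_mem_nhdsWithin _ (Metric.ball_mem_nhds x one_pos), ?_⟩
  have hfin : volume (strip ∩ Metric.ball x 1) < ⊤ := (measure_mono inter_subset_right).trans_lt measure_ball_lt_top
  haveI : IsFiniteMeasure (volume.restrict (strip ∩ Metric.ball x 1)) := ⟨by rw [Measure.restrict_apply_univ]; exact hfin⟩
  have hm : MemLp (u : ℝ × ℝ → ℝ) 2 (volume.restrict (strip ∩ Metric.ball x 1)) :=
    (Lp.memLp u).mono_measure (Measure.restrict_mono inter_subset_left le_rfl)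
  exact hm.integrable one_le_two

section ident

variable {α : ℝ} (hα : 0 < α) (hα1 : α ≤ 1) {f : ℝ → ℝ → ℝ} (hfn : ∀ n : ℕ, ContDiff ℝ n (uncurry f))
  (hfs : HasCompactSupport (uncurry f)) {U : ℕ → E4}
  (hU : ∀ j, IsWeakSol α (toL2 fun p : ℝ × ℝ => (Dz^[j] f) p.1 p.2) (U j))
  {Ψ : ℝ × ℝ → ℝ} (hΨ : ContDiffOn ℝ ∞ Ψ strip)
  (hae : ∀ᵐ y ∂(volume : Measure (ℝ × ℝ)), y ∈ strip → (U 0 0 : ℝ × ℝ → ℝ) y = Ψ y)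

include hα hα1 hfn hfs hU hΨ hae

/-- **`U⁽ʲ⁾₀ = D_R^jΨ̃` a.e. on the strip.** [cite: Elgindi2021, §7.3 proof of Proposition 7.7, Step 3 (p. 21 of arXiv:1904.04795)] -/
theorem weakSol_zero_ae_eq (j : ℕ) :
    ∀ᵐ y ∂(volume : Measure (ℝ × ℝ)), y ∈ strip → (U j 0 : ℝ × ℝ → ℝ) y = (Dz^[j] fun R θ => Ψ (R, θ)) y.1 y.2 := by
  induction j with
  | zero =>
    refine hae.mono fun y hy hys => ?_
    rw [hy hys]; rfl
  | succ j ih =>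
    have hf1 : ContDiff ℝ 1 (uncurry (Dz^[j] f)) := contDiff_iterate_Dz_of_contDiff (n := 1) (m := j) (by simpa using hfn (1 + j))
    have hsj : HasCompactSupport (uncurry (Dz^[j] f)) := hasCompactSupport_iterate_Dz hfs j
    have hU' : IsWeakSol α (toL2 fun p : ℝ × ℝ => p.1 * dz (Dz^[j] f) p.1 p.2) (U (j + 1)) := by
      have e : (fun p : ℝ × ℝ => (Dz^[j + 1] f) p.1 p.2) = fun p : ℝ × ℝ => p.1 * dz (Dz^[j] f) p.1 p.2 := by
        funext p; rw [Function.iterate_succ_apply']; rfl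
      have := hU (j + 1); rwa [e] at this
    have hlim := tendsto_diffQuot_weakSol hα hα1 hf1 hsj (hU j) hU'
    have hVsm := contDiffOn_iterate_Dz_strip hΨ j
    have hVsm1 := contDiffOn_iterate_Dz_strip hΨ (j + 1)
    refine ae_eq_on_strip_of_test (locallyIntegrableOn_L2 (U (j + 1) 0)) ?_ fun φ hφ hφs hφS => ?_
    · have : ContinuousOn (uncurry (Dz^[j + 1] fun R θ => Ψ (R, θ))) strip := hVsm1.continuousOn
      exact this.comp (continuous_fst.prodMk continuous_snd).continuousOn fun y hy => by simpa using hy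
    have mφ : MemLp (fun p : ℝ × ℝ => φ p.1 p.2) 2 stripMeasure := memLp_strip_of_continuous (hφ 0).continuous hφs
    have mD : MemLp (fun p : ℝ × ℝ => φ p.1 p.2 + p.1 * dz φ p.1 p.2) 2 stripMeasure :=
      memLp_strip_of_continuous (by have := (contDiff_dz_of_contDiff (n := 0) (hφ 1)).continuous; have := (hφ 0).continuous; fun_prop)
        (hφs.add ((hasCompactSupport_dz hφs).mul_left))
    have h1 := inner_radialDeriv_component hlim (hφ 1) hφs 0
    rw [inner_toL2_eq_integral _ mφ, inner_toL2_eq_integral _ mD] at h1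
    rw [h1]
    -- replace `U⁽ʲ⁾₀` by `D_R^jΨ̃` and integrate by parts
    have e2 : ∫ p in strip, (U j 0 : ℝ × ℝ → ℝ) p * (φ p.1 p.2 + p.1 * dz φ p.1 p.2) =
        ∫ p in strip, (fun y : ℝ × ℝ => (Dz^[j] fun R θ => Ψ (R, θ)) y.1 y.2) p * (φ p.1 p.2 + p.1 * dz φ p.1 p.2) := by
      refine integral_congr_ae ?_
      have ih' : ∀ᵐ y ∂(volume.restrict strip), (U j 0 : ℝ × ℝ → ℝ) y = (Dz^[j] fun R θ => Ψ (R, θ)) y.1 y.2 :=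
        (ae_restrict_iff' measurableSet_strip).2 ih
      filter_upwards [ih'] with y hy
      rw [hy]
    have hg : ContDiffOn ℝ ∞ (fun y : ℝ × ℝ => (Dz^[j] fun R θ => Ψ (R, θ)) y.1 y.2) strip :=
      hVsm.congr fun y _ => by simp [uncurry]
    rw [e2, ← neg_neg (∫ p in strip, (fun y : ℝ × ℝ => (Dz^[j] fun R θ => Ψ (R, θ)) y.1 y.2) p * _),
      ← integral_strip_Dz_mul_test hg hφ hφs hφS, neg_neg]
    refine integral_congr_ae (ae_of_all _ fun p => ?_)
    show Dz (fun R θ => (Dz^[j] fun R θ => Ψ (R, θ)) (R, θ).1 (R, θ).2) p.1 p.2 * φ p.1 p.2 = (Dz^[j + 1] fun R θ => Ψ (R, θ)) p.1 p.2 * φ p.1 p.2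
    rw [Function.iterate_succ_apply']

/-- **`U⁽ʲ⁾₂ = ∂_θD_R^jΨ̃` a.e. on the strip.** [folklore] -/
theorem weakSol_two_ae_eq (j : ℕ) :
    ∀ᵐ y ∂(volume : Measure (ℝ × ℝ)), y ∈ strip → (U j 2 : ℝ × ℝ → ℝ) y = dθ (Dz^[j] fun R θ => Ψ (R, θ)) y.1 y.2 := by
  have h0 := weakSol_zero_ae_eq hα hα1 hfn hfs hU hΨ hae j
  have hVsm := contDiffOn_iterate_Dz_strip hΨ j
  refine ae_eq_on_strip_of_test (locallyIntegrableOn_L2 (U j 2)) ?_ fun φ hφ hφs hφS => ?_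
  · have : ContinuousOn (uncurry (dθ (Dz^[j] fun R θ => Ψ (R, θ)))) strip :=
      (contDiffOn_dθ (n := 0) ((contDiffOn_infty.1 hVsm 1).of_le (by norm_num))).continuousOn
    exact this.comp (continuous_fst.prodMk continuous_snd).continuousOn fun y hy => by simpa using hy
  have mφ : MemLp (fun p : ℝ × ℝ => φ p.1 p.2) 2 stripMeasure := memLp_strip_of_continuous (hφ 0).continuous hφs
  have mD : MemLp (fun p : ℝ × ℝ => dθ φ p.1 p.2) 2 stripMeasure :=
    memLp_strip_of_continuous (contDiff_dθ_of_contDiff (n := 0) (hφ 1)).continuous (hasCompactSupport_dθ_of hφs)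
  have h1 := weakSpace_inner_two (hφ 1) hφs (fun p hp => hφS hp) (hU j).mem
  rw [inner_toL2_eq_integral _ mφ, inner_toL2_eq_integral _ mD] at h1
  rw [h1]
  have e2 : ∫ p in strip, (U j 0 : ℝ × ℝ → ℝ) p * dθ φ p.1 p.2 =
      ∫ p in strip, (fun y : ℝ × ℝ => (Dz^[j] fun R θ => Ψ (R, θ)) y.1 y.2) p * dθ φ p.1 p.2 := by
    refine integral_congr_ae ?_
    filter_upwards [(ae_restrict_iff' measurableSet_strip).2 h0] with y hy
    rw [hy]
  have hg : ContDiffOn ℝ ∞ (fun y : ℝ × ℝ => (Dz^[j] fun R θ => Ψ (R, θ)) y.1 y.2) strip :=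
    hVsm.congr fun y _ => by simp [uncurry]
  rw [e2, ← neg_neg (∫ p in strip, (fun y : ℝ × ℝ => (Dz^[j] fun R θ => Ψ (R, θ)) y.1 y.2) p * _),
    ← integral_strip_dθ_mul_test hg hφ hφs hφS, neg_neg]

/-- **`U⁽ʲ⁾₃ = tan θ·D_R^jΨ̃` a.e. on the strip.** [folklore] -/
theorem weakSol_three_ae_eq (j : ℕ) :
    ∀ᵐ y ∂(volume : Measure (ℝ × ℝ)), y ∈ strip → (U j 3 : ℝ × ℝ → ℝ) y = Real.tan y.2 * (Dz^[j] fun R θ => Ψ (R, θ)) y.1 y.2 := by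
  have h0 := weakSol_zero_ae_eq hα hα1 hfn hfs hU hΨ hae j
  have hVsm := contDiffOn_iterate_Dz_strip hΨ j
  refine ae_eq_on_strip_of_test (locallyIntegrableOn_L2 (U j 3)) ?_ fun φ hφ hφs hφS => ?_
  · have hc : ContinuousOn (uncurry (Dz^[j] fun R θ => Ψ (R, θ))) strip := hVsm.continuousOn
    have htan : ContinuousOn (fun y : ℝ × ℝ => Real.tan y.2) strip := by
      intro y hy
      have hcos : Real.cos y.2 ≠ 0 := (Real.cos_pos_of_mem_Ioo ⟨by linarith [hy.2.1, Real.pi_pos], hy.2.2⟩).ne'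
      exact ((Real.continuousAt_tan.2 hcos).comp continuousAt_snd).continuousWithinAt
    exact htan.mul (hc.comp (continuous_fst.prodMk continuous_snd).continuousOn fun y hy => by simpa using hy)
  have mφ : MemLp (fun p : ℝ × ℝ => φ p.1 p.2) 2 stripMeasure := memLp_strip_of_continuous (hφ 0).continuous hφs
  have mT : MemLp (fun p : ℝ × ℝ => Real.tan p.2 * φ p.1 p.2) 2 stripMeasure :=
    memLp_strip_of_continuous (continuous_tan_mul_test (hφ 1) hφS) hφs.mul_left
  have h1 := weakSpace_inner_three (hφ 1) hφs (fun p hp => hφS hp) (hU j).mem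
  rw [inner_toL2_eq_integral _ mφ, inner_toL2_eq_integral _ mT] at h1
  rw [h1]
  refine integral_congr_ae ?_
  filter_upwards [(ae_restrict_iff' measurableSet_strip).2 h0] with y hy
  rw [hy]; ring

/-! ### Square integrability of the tangential derivatives -/

omit hα hα1 hfn hfs hU hΨ hae in
/-- Transfer of square integrability along an a.e. identification with an `L²(strip)` class. [folklore] -/
theorem integrableOn_sq_of_ae_eq (u : L2Strip) {v : ℝ × ℝ → ℝ}
    (h : ∀ᵐ y ∂(volume : Measure (ℝ × ℝ)), y ∈ strip → (u : ℝ × ℝ → ℝ) y = v y) :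
    IntegrableOn (fun y => v y ^ 2) strip := by
  have h1 : Integrable (fun y => (u : ℝ × ℝ → ℝ) y ^ 2) (volume.restrict strip) := (Lp.memLp u).integrable_sq
  refine h1.congr ?_
  filter_upwards [(ae_restrict_iff' measurableSet_strip).2 h] with y hy
  rw [hy]

omit hα hα1 hfn hfs hU hΨ hae in
/-- Transfer of weighted square integrability along an a.e. identification. [folklore] -/
theorem integrableOn_weighted_sq_of_ae_eq (u : L2Strip) {v : ℝ × ℝ → ℝ}
    (hw : IntegrableOn (fun y => radialWeight y.1 ^ 2 * (u : ℝ × ℝ → ℝ) y ^ 2) strip)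
    (h : ∀ᵐ y ∂(volume : Measure (ℝ × ℝ)), y ∈ strip → (u : ℝ × ℝ → ℝ) y = v y) :
    IntegrableOn (fun y => radialWeight y.1 ^ 2 * v y ^ 2) strip := by
  refine hw.congr ?_
  filter_upwards [(ae_restrict_iff' measurableSet_strip).2 h] with y hy
  rw [hy]

/-- **All `D_R^jΨ̃`, `∂_θD_R^jΨ̃`, `tan θ·D_R^jΨ̃` are square integrable on the strip.**
[cite: Elgindi2021, §7.3 proof of Proposition 7.7, Step 3 (p. 21 of arXiv:1904.04795)] -/
theorem tangential_sq_integrable (j : ℕ) :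
    IntegrableOn (fun y : ℝ × ℝ => (Dz^[j] fun R θ => Ψ (R, θ)) y.1 y.2 ^ 2) strip ∧
    IntegrableOn (fun y : ℝ × ℝ => dθ (Dz^[j] fun R θ => Ψ (R, θ)) y.1 y.2 ^ 2) strip ∧
    IntegrableOn (fun y : ℝ × ℝ => (Real.tan y.2 * (Dz^[j] fun R θ => Ψ (R, θ)) y.1 y.2) ^ 2) strip :=
  ⟨integrableOn_sq_of_ae_eq (U j 0) (weakSol_zero_ae_eq hα hα1 hfn hfs hU hΨ hae j),
   integrableOn_sq_of_ae_eq (U j 2) (weakSol_two_ae_eq hα hα1 hfn hfs hU hΨ hae j),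
   integrableOn_sq_of_ae_eq (U j 3) (weakSol_three_ae_eq hα hα1 hfn hfs hU hΨ hae j)⟩

omit hα hα1 hU hΨ hae in
/-- The weighted datum `w²(D_R^jf)²` is integrable on the strip when `f` is supported inside `R > 0`. [folklore] -/
theorem integrableOn_weighted_datum (hfpos : ∀ p ∈ tsupport (uncurry f), 0 < p.1) (j : ℕ) :
    IntegrableOn (fun p : ℝ × ℝ => radialWeight p.1 ^ 2 * (toL2 (fun p : ℝ × ℝ => (Dz^[j] f) p.1 p.2) : ℝ × ℝ → ℝ) p ^ 2) strip := by
  have hjn : ContDiff ℝ ∞ (uncurry (Dz^[j] f)) :=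
    contDiff_infty.2 fun n => contDiff_iterate_Dz_of_contDiff (n := n) (m := j) (by simpa using hfn (n + j))
  have hjs : HasCompactSupport (uncurry (Dz^[j] f)) := hasCompactSupport_iterate_Dz hfs j
  have hjpos : ∀ p ∈ tsupport (uncurry (Dz^[j] f)), 0 < p.1 := fun p hp => hfpos p (tsupport_iterate_Dz_subset j hp)
  -- `p ↦ (D_R^jf)(p)² · w(p.1)²` is smooth with compact support
  have hsq : ContDiff ℝ ∞ fun p : ℝ × ℝ => uncurry (Dz^[j] f) p ^ 2 := hjn.pow 2
  have hsqS : tsupport (fun p : ℝ × ℝ => uncurry (Dz^[j] f) p ^ 2) ⊆ {p : ℝ × ℝ | 0 < p.1} := by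
    intro p hp
    have e : (fun p : ℝ × ℝ => uncurry (Dz^[j] f) p ^ 2) = fun p => uncurry (Dz^[j] f) p * uncurry (Dz^[j] f) p := by
      funext q; ring
    rw [e] at hp
    exact hjpos p (tsupport_mul_subset_left hp)
  have hO : IsOpen {p : ℝ × ℝ | 0 < p.1} := isOpen_lt continuous_const continuous_fst
  have hw : ContDiffOn ℝ ∞ (fun p : ℝ × ℝ => radialWeight p.1 ^ 2) {p : ℝ × ℝ | 0 < p.1} := by
    intro p hp
    have hp' : (p.1 : ℝ) ≠ 0 := ne_of_gt hp
    have h1 : ContDiffAt ℝ ∞ (fun p : ℝ × ℝ => (1 + p.1) ^ 2) p := by fun_prop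
    have h2 : ContDiffAt ℝ ∞ (fun p : ℝ × ℝ => p.1 ^ 2) p := by fun_prop
    have : ContDiffAt ℝ ∞ (fun p : ℝ × ℝ => radialWeight p.1 ^ 2) p := by
      unfold radialWeight
      exact (h1.div h2 (pow_ne_zero 2 hp')).pow 2
    exact this.contDiffWithinAt
  have hprod : ContDiff ℝ ∞ fun p : ℝ × ℝ => uncurry (Dz^[j] f) p ^ 2 * radialWeight p.1 ^ 2 :=
    Literature.Analysis.Distribution.contDiff_mul_of_tsupport_subset hO hsq hsqS hw
  have hps : HasCompactSupport fun p : ℝ × ℝ => uncurry (Dz^[j] f) p ^ 2 * radialWeight p.1 ^ 2 := by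
    have e : (fun p : ℝ × ℝ => uncurry (Dz^[j] f) p ^ 2) = fun p => uncurry (Dz^[j] f) p * uncurry (Dz^[j] f) p := by
      funext q; ring
    have : HasCompactSupport fun p : ℝ × ℝ => uncurry (Dz^[j] f) p ^ 2 := by rw [e]; exact hjs.mul_left
    exact this.mul_right
  have hint : Integrable fun p : ℝ × ℝ => uncurry (Dz^[j] f) p ^ 2 * radialWeight p.1 ^ 2 :=
    hprod.continuous.integrable_of_hasCompactSupport hps
  refine hint.integrableOn.congr ?_
  have hm : MemLp (fun p : ℝ × ℝ => (Dz^[j] f) p.1 p.2) 2 stripMeasure :=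
    memLp_strip_of_continuous (hjn.continuous.comp (continuous_fst.prodMk continuous_snd) |>.congr fun p => by simp [uncurry]) hjs
  filter_upwards [toL2_ae_eq' hm] with p hp
  rw [hp]; simp only [uncurry]; ring

/-- **Weighted square integrability of the tangential derivatives** (`0 < α ≤ 1/4`): for a datum
supported inside `R > 0`, `w·D_R^jΨ̃, w·∂_θD_R^jΨ̃, w·tan θD_R^jΨ̃ ∈ L²(strip)`, `w = (1+R)²/R²`.
[cite: Elgindi2021, §7.1 Proposition 7.1 with the weight of §1.7.2 (pp. 7, 19 of arXiv:1904.04795)] -/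
theorem tangential_weighted_sq_integrable (hα4 : α ≤ 1 / 4) (hfpos : ∀ p ∈ tsupport (uncurry f), 0 < p.1) (j : ℕ) :
    IntegrableOn (fun y : ℝ × ℝ => radialWeight y.1 ^ 2 * (Dz^[j] fun R θ => Ψ (R, θ)) y.1 y.2 ^ 2) strip ∧
    IntegrableOn (fun y : ℝ × ℝ => radialWeight y.1 ^ 2 * dθ (Dz^[j] fun R θ => Ψ (R, θ)) y.1 y.2 ^ 2) strip ∧
    IntegrableOn (fun y : ℝ × ℝ => radialWeight y.1 ^ 2 * (Real.tan y.2 * (Dz^[j] fun R θ => Ψ (R, θ)) y.1 y.2) ^ 2) strip := by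
  have hF := integrableOn_weighted_datum hfn hfs hfpos j
  have hw := fun k => (weightedEnergy_le hα hα4 (hU j).mem (hU j).eq hF k).1
  exact ⟨integrableOn_weighted_sq_of_ae_eq (U j 0) (hw 0) (weakSol_zero_ae_eq hα hα1 hfn hfs hU hΨ hae j),
    integrableOn_weighted_sq_of_ae_eq (U j 2) (hw 2) (weakSol_two_ae_eq hα hα1 hfn hfs hU hΨ hae j),
    integrableOn_weighted_sq_of_ae_eq (U j 3) (hw 3) (weakSol_three_ae_eq hα hα1 hfn hfs hU hΨ hae j)⟩

end ident

end Elgindi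

end Literature.Analysis.FluidPDE
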